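import Mathlib
import Summits.Ventures.PercRepro2.HCovMinEndInduction

/-!
# The deterministic base is in the tree: the crux from (MIN-END) alone (blind cell PercRepro2,
night-1 g18; NIGHT1-G18.md §6)

A weight vector with every weight in `{0, 1}` has no fractional edge, hence no fractional root edge,
and mine-a's base lemma `Chord.Gc_eq_zero_of_rootEdges_empty` gives `Gc = 0`:

* **`deterministic_HCov_all`**: `MinEnd.Deterministic_HCov_all R` is a theorem;
* **`HCov_all_of_minEndEdge`**: `MinEndHCovEdge_all R → CovForm.HCov_all R` — the crux of record
  from the candidate row (MIN-END) along every edge, nothing else.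

Own code; standard axioms.
-/

namespace Summit.Ventures.PercRepro2

open UnionCluster CovForm

namespace MinEnd

section Base

variable {V : Type*} {E : Type*} [Fintype E] [DecidableEq E]
  {R : Type*} [Field R] [LinearOrder R] [IsStrictOrderedRing R]

omit [DecidableEq E] [IsStrictOrderedRing R] in
/-- A deterministic vector has no fractional edge. -/
lemma frac_eq_empty_of_deterministic {p : E → R} (h : ∀ e, p e = 0 ∨ p e = 1) :
    Chord.frac p = ∅ := by
  ext e
  simp only [Chord.mem_frac, Finset.notMem_empty, iff_false, not_and, not_not]
  intro h0
  rcases h e with h1 | h1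
  · exact absurd h1 h0
  · exact h1

omit [DecidableEq E] [IsStrictOrderedRing R] in
/-- A deterministic vector has no fractional root edge. -/
lemma rootEdges_eq_empty_of_deterministic {p : E → R} (h : ∀ e, p e = 0 ∨ p e = 1)
    (ends : E → Sym2 V) (a₁ a₂ : V) : Chord.rootEdges p ends a₁ a₂ = ∅ := by
  classical
  unfold Chord.rootEdges
  rw [frac_eq_empty_of_deterministic h]
  exact Finset.filter_empty _

/-- **(HCOV) at every deterministic vector**: `Gc = 0` there (mine-a's base lemma). -/
theorem HCov_of_deterministic {p : E → R} (h : ∀ e, p e = 0 ∨ p e = 1) (ends : E → Sym2 V)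
    (o a₁ a₂ a₃ b : V) : HCov p ends o a₁ a₂ a₃ b := by
  unfold HCov
  rw [Chord.Gc_eq_zero_of_rootEdges_empty (rootEdges_eq_empty_of_deterministic h ends a₁ a₂)]

end Base

section Closure

variable (R : Type*) [Field R] [LinearOrder R] [IsStrictOrderedRing R]

/-- **The deterministic base is a theorem.** -/
theorem deterministic_HCov_all : Deterministic_HCov_all R :=
  fun _ _ _ _ _ _ ends _ hdet o a₁ a₂ a₃ b => HCov_of_deterministic hdet ends o a₁ a₂ a₃ b

/-- **The crux of record from (MIN-END) alone**: `MinEndHCovEdge_all R → CovForm.HCov_all R`. -/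
theorem HCov_all_of_minEndEdge (hmin : MinEndHCovEdge_all R) : CovForm.HCov_all R :=
  HCov_all_of_minEnd R hmin (deterministic_HCov_all R)

end Closure

end MinEnd

end Summit.Ventures.PercRepro2
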